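import Summits.Ventures.CertifiedManyBodySolver.Theorems.TcThermcert1FreeGasWitnessProps
import HarnessLib

/-!
# Free-gas (`U = 0`) sector witness for TcThermcert1's K1 family — part 8: the pointwise circle bound (arc + off-arc) for the twisted generating polynomial

`pointwise_circle_bound`: on the mode circle `|t| = e^s`, the twisted generating polynomials `∏_k (1 + t e^{iφ} w_k(β,θ))` at flux `θ` and
at flux `0` differ by at most `P₀(t) · (2δ_L + 4e^{−cL²})`, `δ_L = 128·B·L⁴ e^{−aL}`-type — the ARC part from the shifted-grid trapezoid
bound applied line by line (`norm_lineSum_sub_le`, one-line logarithm `lineLog`), the OFF-ARC part from the Gaussian decay.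
HONEST FRAMING: statements about the FREE (`U = 0`) twisted torus gas and about symmetric functions of explicit reals;
nothing here touches `U = 8`; superconductivity in the Hubbard model is NOT proved (or disproved) by any of this.
Provenance: landed form of the crux workfile `Cruxes/ThermalStiffnessCeilingU8b10_le_1o8/FreeGasArcSkeleton.lean` v4.1 (tree 80a90c42bbb7)
+ `FreeGasArcInputs.lean` (d3c3c585d14e), planner `hubbard-floor-idea-rescuer` g5, card `free-gas-arc-darroch` (crit-1 KEEP);
hubbard-floor support target ST-K1-U0-1, `--supports stmt-Ventures-26381` (TcThermcert1 crux K1). Split into ≤ 400-line modules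
`Theorems/TcThermcert1FreeGas*.lean`.
-/

noncomputable section

namespace Summit.Ventures.CertifiedManyBodySolver.Theorems.FreeGasArc

open Filter Topology Set Real Finset
open Summit.Ventures.CertifiedManyBodySolver.Observables
open Literature.MathematicalPhysics.QuantumLattice
open Literature.Probability.LatticeModels (TorusSite latticeMomentum)
open scoped BigOperators

/-! ## §4 The assembly (v3): `EsymmLogTwistInsensitive` PROVED from the inputs of §3 / `FreeGasArcInputs` -/

/-- `∑_{j ∈ ℤ/Lℤ} g(j.val) = ∑_{j < L} g j`. -/
theorem sum_zmod_val_eq_sum_range (L : ℕ) [NeZero L] (g : ℕ → ℂ) :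
    ∑ j : ZMod L, g j.val = ∑ j ∈ Finset.range L, g j := by
  obtain ⟨n, hn⟩ := Nat.exists_eq_succ_of_ne_zero (NeZero.ne L)
  subst hn
  exact Fin.sum_univ_eq_sum_range g (n + 1)

/-- The one-line logarithm `v_{β,s,φ,p₂}(z) = Log(1 + exp(s + iφ + 2β cos z + 2β cos p₂))` (the `let v` of
`FreeGasArc.Inputs.FreeBandLogStrip`). -/
def lineLog (β s φ p₂ : ℝ) : ℂ → ℂ := fun z =>
  Complex.log (1 + Complex.exp ((s : ℂ) + (φ : ℂ) * Complex.I + 2 * β * Complex.cos z + 2 * β * Real.cos p₂))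

/-- Each factor of the generating product is `1 + exp(s + iφ + 2β cos(p₁ − θ/L) + 2β cos p₂)`. -/
theorem freeWeight_factor (L : ℕ) (β θ s φ : ℝ) (k : TorusSite 2 L) :
    (1 : ℂ) + ((Real.exp s * freeWeight L β θ k : ℝ) : ℂ) * Complex.exp (φ * Complex.I) =
      1 + Complex.exp ((s : ℂ) + (φ : ℂ) * Complex.I + 2 * β * Real.cos (latticeMomentum L k 0 - θ / L) +
        2 * β * Real.cos (latticeMomentum L k 1)) := by
  have hw : Real.exp s * freeWeight L β θ k =
      Real.exp (s + 2 * β * Real.cos (latticeMomentum L k 0 - θ / L) + 2 * β * Real.cos (latticeMomentum L k 1)) := by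
    rw [freeWeight, ← Real.exp_add]
    congr 1
    simp [twistedBand, Fin.sum_univ_two]
    ring
  rw [hw, Complex.ofReal_exp, ← Complex.exp_add]
  congr 2
  push_cast
  ring

/-- On the arc the generating product is `exp` of the sum of one-line logarithms. -/
theorem prod_factor_eq_exp_sum (L : ℕ) [NeZero L] (β θ s φ : ℝ)
    (hExp : ∀ p₂ p₁ : ℝ, Complex.exp (lineLog β s φ p₂ p₁) =
      1 + Complex.exp ((s : ℂ) + (φ : ℂ) * Complex.I + 2 * β * Real.cos p₁ + 2 * β * Real.cos p₂)) :
    ∏ k : TorusSite 2 L, ((1 : ℂ) + ((Real.exp s * freeWeight L β θ k : ℝ) : ℂ) * Complex.exp (φ * Complex.I)) =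
      Complex.exp (∑ k : TorusSite 2 L,
        lineLog β s φ (latticeMomentum L k 1) ((latticeMomentum L k 0 - θ / L : ℝ) : ℂ)) := by
  rw [Complex.exp_sum]
  refine Finset.prod_congr rfl fun k _ => ?_
  rw [freeWeight_factor, hExp]

/-- ARC STEP: the sum of one-line logarithms moves by at most `L · 4LB/(e^{aL} − 1)` under the twist
(`FreeGasArc.Inputs.shiftedTrapezoidShift_holds`, line by line in the transverse momentum). -/
theorem norm_lineSum_sub_le (L : ℕ) [NeZero L] (β θ s φ : ℝ) {a B : ℝ}
    (hST : FreeGasArc.Inputs.ShiftedTrapezoidShift) (ha : 0 < a) (hB : 0 ≤ B)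
    (hv : ∀ p₂ : ℝ, (∀ z : ℂ, lineLog β s φ p₂ (z + 2 * π) = lineLog β s φ p₂ z) ∧
      DifferentiableOn ℂ (lineLog β s φ p₂) {z : ℂ | |z.im| < a} ∧
      (∀ z : ℂ, |z.im| < a → ‖lineLog β s φ p₂ z‖ ≤ B)) :
    ‖∑ k : TorusSite 2 L, lineLog β s φ (latticeMomentum L k 1) ((latticeMomentum L k 0 - θ / L : ℝ) : ℂ) -
        ∑ k : TorusSite 2 L, lineLog β s φ (latticeMomentum L k 1) ((latticeMomentum L k 0 - 0 / L : ℝ) : ℂ)‖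
      ≤ L * (4 * L * B / (Real.exp (a * L) - 1)) := by
  have hL : 0 < L := Nat.pos_of_ne_zero (NeZero.ne L)
  have hre : ∀ θ' : ℝ, ∑ k : TorusSite 2 L,
      lineLog β s φ (latticeMomentum L k 1) ((latticeMomentum L k 0 - θ' / L : ℝ) : ℂ)
      = ∑ b : ZMod L, ∑ j ∈ Finset.range L,
          lineLog β s φ (2 * π * ((b.val : ℕ) : ℝ) / L) (((2 * π * (j : ℝ) + -θ') / (L : ℝ) : ℝ) : ℂ) := by
    intro θ'
    rw [← (piFinTwoEquiv fun _ : Fin 2 => ZMod L).symm.sum_comp, Fintype.sum_prod_type, Finset.sum_comm]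
    refine Finset.sum_congr rfl fun b _ => ?_
    rw [← sum_zmod_val_eq_sum_range L (fun j => lineLog β s φ (2 * π * ((b.val : ℕ) : ℝ) / L)
      (((2 * π * (j : ℝ) + -θ') / (L : ℝ) : ℝ) : ℂ))]
    refine Finset.sum_congr rfl fun j _ => ?_
    simp only [piFinTwoEquiv_symm_apply, Fin.cons_zero, Fin.cons_one, latticeMomentum]
    congr 1
    push_cast
    ring
  rw [hre θ, hre 0, ← Finset.sum_sub_distrib]
  calc ‖∑ b : ZMod L, (∑ j ∈ Finset.range L,
          lineLog β s φ (2 * π * ((b.val : ℕ) : ℝ) / L) (((2 * π * (j : ℝ) + -θ) / (L : ℝ) : ℝ) : ℂ) -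
        ∑ j ∈ Finset.range L,
          lineLog β s φ (2 * π * ((b.val : ℕ) : ℝ) / L) (((2 * π * (j : ℝ) + -0) / (L : ℝ) : ℝ) : ℂ))‖
      ≤ ∑ b : ZMod L, ‖∑ j ∈ Finset.range L,
          lineLog β s φ (2 * π * ((b.val : ℕ) : ℝ) / L) (((2 * π * (j : ℝ) + -θ) / (L : ℝ) : ℝ) : ℂ) -
        ∑ j ∈ Finset.range L,
          lineLog β s φ (2 * π * ((b.val : ℕ) : ℝ) / L) (((2 * π * (j : ℝ) + -0) / (L : ℝ) : ℝ) : ℂ)‖ :=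
        norm_sum_le _ _
    _ ≤ ∑ _b : ZMod L, 4 * L * B / (Real.exp (a * L) - 1) := Finset.sum_le_sum fun b _ => ?_
    _ = L * (4 * L * B / (Real.exp (a * L) - 1)) := by
        rw [Finset.sum_const, Finset.card_univ, ZMod.card, nsmul_eq_mul]
  obtain ⟨hper, hdiff, hbd⟩ := hv (2 * π * ((b.val : ℕ) : ℝ) / L)
  have h := hST (lineLog β s φ (2 * π * ((b.val : ℕ) : ℝ) / L)) a B ha hB hper hdiff hbd L hL (-θ)
  have h0 : ∑ j ∈ Finset.range L,
      lineLog β s φ (2 * π * ((b.val : ℕ) : ℝ) / L) (((2 * π * (j : ℝ) + -0) / (L : ℝ) : ℝ) : ℂ)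
      = ∑ j ∈ Finset.range L, lineLog β s φ (2 * π * ((b.val : ℕ) : ℝ) / L) (((2 * π * (j : ℝ)) / (L : ℝ) : ℝ) : ℂ) := by
    simp only [neg_zero, add_zero]
  rw [h0]
  exact h

/-- `‖∏_k (1 + u_k e^{iφ})‖ ≤ ∏_k (1 + u_k)` for the free weights. -/
theorem norm_prod_factor_le (L : ℕ) [NeZero L] (β θ s φ : ℝ) :
    ‖∏ k : TorusSite 2 L, ((1 : ℂ) + ((Real.exp s * freeWeight L β θ k : ℝ) : ℂ) * Complex.exp (φ * Complex.I))‖ ≤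
      ∏ k : TorusSite 2 L, (1 + Real.exp s * freeWeight L β θ k) := by
  rw [norm_prod]
  refine Finset.prod_le_prod (fun _ _ => norm_nonneg _) fun k _ => ?_
  have hu : 0 < Real.exp s * freeWeight L β θ k := mul_pos (Real.exp_pos _) (Real.exp_pos _)
  calc ‖(1 : ℂ) + ((Real.exp s * freeWeight L β θ k : ℝ) : ℂ) * Complex.exp (φ * Complex.I)‖
      ≤ ‖(1 : ℂ)‖ + ‖((Real.exp s * freeWeight L β θ k : ℝ) : ℂ) * Complex.exp (φ * Complex.I)‖ := norm_add_le _ _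
    _ = 1 + Real.exp s * freeWeight L β θ k := by
        rw [norm_one, norm_mul, Complex.norm_real, Complex.norm_exp_ofReal_mul_I, mul_one, Real.norm_eq_abs,
          abs_of_pos hu]

/-- POINTWISE CIRCLE BOUND: arc (trapezoid shift) + off-arc (Gaussian decay) give
`‖P_θ(φ) − P₀(φ)‖ ≤ ∏(1 + e^{s}w₀)·(2δ + 4e^{−cL²})` on the whole circle. -/
theorem pointwise_circle_bound (L : ℕ) [NeZero L] (β θ s : ℝ) {a B c δ : ℝ}
    (hST : FreeGasArc.Inputs.ShiftedTrapezoidShift) (hOA : FreeGasArc.Inputs.OffArcGaussianDecay)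
    (ha : 0 < a) (hB : 0 ≤ B)
    (hstripφ : ∀ φ' : ℝ, |φ'| ≤ π / 2 → ∀ p₂ : ℝ,
      (∀ z : ℂ, lineLog β s φ' p₂ (z + 2 * π) = lineLog β s φ' p₂ z) ∧
      DifferentiableOn ℂ (lineLog β s φ' p₂) {z : ℂ | |z.im| < a} ∧
      (∀ z : ℂ, |z.im| < a → ‖lineLog β s φ' p₂ z‖ ≤ B) ∧
      (∀ p₁ : ℝ, Complex.exp (lineLog β s φ' p₂ p₁) =
        1 + Complex.exp ((s : ℂ) + (φ' : ℂ) * Complex.I + 2 * β * Real.cos p₁ + 2 * β * Real.cos p₂)))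
    (hδ : (L : ℝ) * (4 * L * B / (Real.exp (a * L) - 1)) ≤ δ) (hδ0 : 0 ≤ δ) (hδ1 : δ ≤ 1)
    (hVθ : c * (L : ℝ) ^ 2 ≤ ∑ k : TorusSite 2 L,
      Real.exp s * freeWeight L β θ k / (1 + Real.exp s * freeWeight L β θ k) ^ 2)
    (hV0 : c * (L : ℝ) ^ 2 ≤ ∑ k : TorusSite 2 L,
      Real.exp s * freeWeight L β 0 k / (1 + Real.exp s * freeWeight L β 0 k) ^ 2) :
    ∀ φ : ℝ, φ ∈ Set.uIoc (-π) π →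
      ‖∏ k : TorusSite 2 L, ((1 : ℂ) + ((Real.exp s * freeWeight L β θ k : ℝ) : ℂ) * Complex.exp (φ * Complex.I)) -
          ∏ k : TorusSite 2 L, ((1 : ℂ) + ((Real.exp s * freeWeight L β 0 k : ℝ) : ℂ) * Complex.exp (φ * Complex.I))‖
        ≤ (∏ k : TorusSite 2 L, (1 + Real.exp s * freeWeight L β 0 k)) * (2 * δ + 4 * Real.exp (-(c * (L : ℝ) ^ 2))) := by
  intro φ hφ
  set P0 : ℝ := ∏ k : TorusSite 2 L, (1 + Real.exp s * freeWeight L β 0 k) with hP0def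
  set Pθ : ℝ := ∏ k : TorusSite 2 L, (1 + Real.exp s * freeWeight L β θ k) with hPθdef
  have hP0 : 0 ≤ P0 := Finset.prod_nonneg fun k _ => by unfold freeWeight; positivity
  have hPθ0 : 0 ≤ Pθ := Finset.prod_nonneg fun k _ => by unfold freeWeight; positivity
  -- arc closeness for every |φ'| ≤ π/2
  have harc : ∀ φ' : ℝ, |φ'| ≤ π / 2 →
      ‖∏ k : TorusSite 2 L, ((1 : ℂ) + ((Real.exp s * freeWeight L β θ k : ℝ) : ℂ) * Complex.exp (φ' * Complex.I)) -
          ∏ k : TorusSite 2 L, ((1 : ℂ) + ((Real.exp s * freeWeight L β 0 k : ℝ) : ℂ) * Complex.exp (φ' * Complex.I))‖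
        ≤ P0 * (2 * δ) := by
    intro φ' hφ'
    have hv := hstripφ φ' hφ'
    have hEθ := prod_factor_eq_exp_sum L β θ s φ' (fun p₂ p₁ => (hv p₂).2.2.2 p₁)
    have hE0 := prod_factor_eq_exp_sum L β 0 s φ' (fun p₂ p₁ => (hv p₂).2.2.2 p₁)
    have hS := norm_lineSum_sub_le L β θ s φ' hST ha hB (fun p₂ => ⟨(hv p₂).1, (hv p₂).2.1, (hv p₂).2.2.1⟩)
    set Sθ := ∑ k : TorusSite 2 L, lineLog β s φ' (latticeMomentum L k 1) ((latticeMomentum L k 0 - θ / L : ℝ) : ℂ)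
    set S0 := ∑ k : TorusSite 2 L, lineLog β s φ' (latticeMomentum L k 1) ((latticeMomentum L k 0 - 0 / L : ℝ) : ℂ)
    have hS1 : ‖Sθ - S0‖ ≤ 1 := (hS.trans hδ).trans hδ1
    have hn0 : ‖Complex.exp S0‖ ≤ P0 := by
      rw [← hE0]
      exact norm_prod_factor_le L β 0 s φ'
    rw [hEθ, hE0, show Complex.exp Sθ - Complex.exp S0 = Complex.exp S0 * (Complex.exp (Sθ - S0) - 1) by
      rw [mul_sub, mul_one, ← Complex.exp_add, add_sub_cancel], norm_mul]
    calc ‖Complex.exp S0‖ * ‖Complex.exp (Sθ - S0) - 1‖ ≤ P0 * (2 * ‖Sθ - S0‖) :=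
          mul_le_mul hn0 (Complex.norm_exp_sub_one_le hS1) (norm_nonneg _) hP0
      _ ≤ P0 * (2 * δ) := by gcongr; exact hS.trans hδ
  -- the twisted real product is at most `3 P0`
  have hPθ : Pθ ≤ 3 * P0 := by
    have h := harc 0 (by rw [abs_zero]; positivity)
    have hreal : ∀ θ' : ℝ, ∏ k : TorusSite 2 L, ((1 : ℂ) + ((Real.exp s * freeWeight L β θ' k : ℝ) : ℂ) *
        Complex.exp ((0 : ℝ) * Complex.I)) = ((∏ k : TorusSite 2 L, (1 + Real.exp s * freeWeight L β θ' k) : ℝ) : ℂ) := by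
      intro θ'
      push_cast
      refine Finset.prod_congr rfl fun k _ => ?_
      simp
    rw [hreal θ, hreal 0, ← Complex.ofReal_sub, Complex.norm_real, Real.norm_eq_abs] at h
    have := (abs_le.1 h).2
    nlinarith [hδ1, hP0]
  by_cases hφa : |φ| ≤ π / 2
  · calc _ ≤ P0 * (2 * δ) := harc φ hφa
      _ ≤ P0 * (2 * δ + 4 * Real.exp (-(c * (L : ℝ) ^ 2))) := by
          gcongr
          linarith [Real.exp_pos (-(c * (L : ℝ) ^ 2))]
  · -- off the arc: `cos φ ≤ 0`
    rw [Set.uIoc_of_le (by linarith [Real.pi_pos]), Set.mem_Ioc] at hφ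
    have hcos : Real.cos φ ≤ 0 := by
      rw [← Real.cos_abs]
      have h1 : π / 2 < |φ| := lt_of_not_ge hφa
      have h2 : |φ| ≤ π := abs_le.2 ⟨by linarith [hφ.1], hφ.2⟩
      exact Real.cos_nonpos_of_pi_div_two_le_of_le h1.le (by linarith [Real.pi_pos])
    have hoff : ∀ θ' : ℝ, c * (L : ℝ) ^ 2 ≤ ∑ k : TorusSite 2 L,
        Real.exp s * freeWeight L β θ' k / (1 + Real.exp s * freeWeight L β θ' k) ^ 2 →
        ‖∏ k : TorusSite 2 L, ((1 : ℂ) + ((Real.exp s * freeWeight L β θ' k : ℝ) : ℂ) * Complex.exp (φ * Complex.I))‖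
          ≤ (∏ k : TorusSite 2 L, (1 + Real.exp s * freeWeight L β θ' k)) * Real.exp (-(c * (L : ℝ) ^ 2)) := by
      intro θ' hV
      have h := hOA (TorusSite 2 L) (fun k => Real.exp s * freeWeight L β θ' k) φ
        (fun k => mul_pos (Real.exp_pos _) (Real.exp_pos _))
      beta_reduce at h
      rw [mul_comm Complex.I (φ : ℂ)] at h
      refine h.trans (mul_le_mul_of_nonneg_left (Real.exp_le_exp.2 ?_)
        (Finset.prod_nonneg fun k _ => by unfold freeWeight; positivity))
      have hVnn : 0 ≤ ∑ k : TorusSite 2 L,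
          Real.exp s * freeWeight L β θ' k / (1 + Real.exp s * freeWeight L β θ' k) ^ 2 :=
        Finset.sum_nonneg fun k _ => by unfold freeWeight; positivity
      nlinarith [hcos, hV, hVnn, mul_nonneg (neg_nonneg.2 hcos) hVnn]
    calc _ ≤ ‖∏ k : TorusSite 2 L, ((1 : ℂ) + ((Real.exp s * freeWeight L β θ k : ℝ) : ℂ) * Complex.exp (φ * Complex.I))‖ +
          ‖∏ k : TorusSite 2 L, ((1 : ℂ) + ((Real.exp s * freeWeight L β 0 k : ℝ) : ℂ) * Complex.exp (φ * Complex.I))‖ :=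
          norm_sub_le _ _
      _ ≤ Pθ * Real.exp (-(c * (L : ℝ) ^ 2)) + P0 * Real.exp (-(c * (L : ℝ) ^ 2)) :=
          add_le_add (hoff θ hVθ) (hoff 0 hV0)
      _ ≤ 3 * P0 * Real.exp (-(c * (L : ℝ) ^ 2)) + P0 * Real.exp (-(c * (L : ℝ) ^ 2)) := by
          gcongr
      _ = P0 * (4 * Real.exp (-(c * (L : ℝ) ^ 2))) := by ring
      _ ≤ P0 * (2 * δ + 4 * Real.exp (-(c * (L : ℝ) ^ 2))) := by
          gcongr
          linarith

end Summit.Ventures.CertifiedManyBodySolver.Theorems.FreeGasArc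

end
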